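import Literature.NumberTheory.LFunctions.WeilCriterionProofs
import Summits.RiemannHypothesis.RiemannHypothesis.Theorems.SignConeSignConeInequalityCriterion
import Summits.RiemannHypothesis.RiemannHypothesis.Theorems.SignConeSignConeOscillatoryStatus

/-!
# The sign-cone criterion in Weil's vocabulary: `SignConeInequality ↔ WeilPositivity`
(route `SignCone`; HELPER file `--supports stmt-RiemannHypothesis-16301` — it closes nothing)

The unconditional criterion `signConeInequality_iff_riemannHypothesis : SignConeInequality ↔
RiemannHypothesis` is in the tree (`SignConeSignConeInequalityCriterion.lean`, p161538: the route's
deciding theorem `closes` over the two CLOSED cruxes `ConeMagnification_proof` — the 2001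
magnification theorem W-MAG, stmt-RiemannHypothesis-16303 — and `SignConeDuality_of` — conic duality
at each cutoff, stmt-RiemannHypothesis-16304; converse by the explicit formula). Composed with the
in-tree Weil criterion `weil_criterion_holds : RiemannHypothesis ↔ WeilPositivity` (Bombieri 2000,
Thm. 2; `Literature/NumberTheory/LFunctions/WeilCriterionProofs.lean`) it reads, unconditionally:

* `signConeInequality_iff_weilPositivity : SignConeInequality ↔ WeilPositivity` — the PRIME-FREE,
  ZERO-FREE sign-cone inequality with unit slack (only the polar and archimedean terms of Weil's
  functional, tested on node-nonnegative autocorrelation sums at every cutoff) is equivalent to the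
  full Weil positivity `W(g ⋆ g̃) ≥ 0` (which carries the prime sum `-∑ Λ(n) n^{-1/2}(…)`);
* the same for the two RH-equivalent supports `SignConeOscillatory`, `OscCoherentCore`
  (previously in the tree only conditionally on the sibling cruxes:
  `signConeOscillatory_iff_weilPositivity_of h₂ h₃ h₄`, `SignConeSignConeOscillatoryStatus.lean`);
* an `example` records that the literal harvest term
  `signConeInequality_iff_riemannHypothesis_of ConeMagnification_proof signConeDuality_proof`
  (status file's `_of` over the two closing theorems) has the type of the landed criterion — not
  re-declared, so the name `signConeInequality_iff_riemannHypothesis` stays single-sourced.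

No new mathematics: every proof term is a composition of declarations already in the tree;
`#print axioms` of each is `propext, Classical.choice, Quot.sound`.
-/

-- the summit-side namespace `Summit.RiemannHypothesis.RiemannHypothesis.…` (D-0017: Sub = Summit) repeats a component
set_option linter.dupNamespace false

namespace Summit.RiemannHypothesis.RiemannHypothesis.Theorems.SignCone

open Literature.NumberTheory.LFunctions
open Summit.RiemannHypothesis.RiemannHypothesis.Theses.SignCone

-- The literal harvest term (status file's `_of` over the two closing theorems
-- `Theorems.ConeMagnification_proof`, `Theorems.SignConeDuality.signConeDuality_proof`) elaborates to
-- the type of the landed criterion; an `example`, so the criterion's name stays single-sourced (p161538).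
example : SignConeInequality ↔ _root_.Summit.RiemannHypothesis :=
  signConeInequality_iff_riemannHypothesis_of
    Summit.RiemannHypothesis.RiemannHypothesis.Theorems.ConeMagnification_proof
    Summit.RiemannHypothesis.RiemannHypothesis.Theorems.SignConeDuality.signConeDuality_proof

/-- **The sign-cone criterion in Weil's vocabulary.** The prime-free unit-slack sign-cone inequality
at every cutoff holds iff Weil's quadratic functional is positive on all test autocorrelations:
`SignConeInequality ↔ WeilPositivity` (criterion p161538 composed with Bombieri's
`weil_criterion_holds`). [folklore] -/
theorem signConeInequality_iff_weilPositivity : SignConeInequality ↔ WeilPositivity :=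
  signConeInequality_iff_riemannHypothesis.trans
    (show _root_.RiemannHypothesis ↔ WeilPositivity from weil_criterion_holds)

/-- `SignConeOscillatory ↔ WeilPositivity`, now unconditional (the `_of h₂ h₃ h₄` version of
`SignConeSignConeOscillatoryStatus.lean` with its three binders discharged through the landed
criterion). [folklore] -/
theorem signConeOscillatory_iff_weilPositivity : SignConeOscillatory ↔ WeilPositivity :=
  signConeOscillatory_iff_riemannHypothesis.trans
    (show _root_.RiemannHypothesis ↔ WeilPositivity from weil_criterion_holds)

/-- `OscCoherentCore ↔ WeilPositivity`, unconditional. [folklore] -/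
theorem oscCoherentCore_iff_weilPositivity : OscCoherentCore ↔ WeilPositivity :=
  oscCoherentCore_iff_riemannHypothesis.trans
    (show _root_.RiemannHypothesis ↔ WeilPositivity from weil_criterion_holds)

end Summit.RiemannHypothesis.RiemannHypothesis.Theorems.SignCone
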